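import Summits.AtomisticToContinuum.HydrodynamicLimit.Theorems.MourreKoopmanChargesLinearToEntropyInBandGalileanRung
import Summits.AtomisticToContinuum.HydrodynamicLimit.Theorems.MourreKoopmanChargesLinearToEntropyInBandStressRung
import HarnessLib

/-!
# The window-variance (Fejér) form of `OneBodyCompleteness` at every drift and every admissible one-body
# field: the `L²` shadow of the kinetic rows of visible flux-Gibbsianity (crux `LinearToEntropyInBand`,
# stmt-AtomisticToContinuum-17740, route `MourreKoopmanCharges`)

Support file (`--supports stmt-AtomisticToContinuum-17740`, registered stub `stub_windowVarianceGalilean`) of the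
line `registered`, skeleton v7 (`Cruxes/LinearToEntropyInBand/Lines/birth.lean`), a rung toward the line's stub 1
`stub_visibleFluxGibbsianity : OneBodyCompleteness → StressStrongMixing → VisibleFluxGibbsianity`.

Visible flux-Gibbsianity asks for exponential moments of WINDOW-AVERAGED empirical currents under the homogeneous
invariant Gibbs law `G_u = localGibbsLaw σ 1 u θ` AT EVERY DRIFT `u`, the kinetic window `w_N = τ(N+1)^{-1/3}`
being sent to infinity AFTER `N → ∞`.  Its first-order (`L²`, second-cumulant) content for the kinetic rows is:
for every continuous `χ` on `𝕋³` and every continuous polynomially bounded velocity profile `h ⊥ {1, vᵢ, |v|²}`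
in `L²(M_{θ,u})`,
`lim_{τ→∞} limsup_N (N+1) · E_{G_u}[((N+1)⁻¹ Σᵢ w_N⁻¹ ∫₀^{w_N} χ(xᵢ(r)) h(vᵢ(r)) dr)²] = 0`
— the shape of the route item `OneFlightGossipEngine.EquilibriumStressVarianceDecay` (stmt-9531, the germ
`φ(x) v⁰v¹` at drift `0`, landed from `OneBodyCompleteness` in `…LinearToEntropyInBandStressRung`) with a GENERAL
admissible field `χ(x) h(v)` and a GENERAL drift.  This file proves it from the route's typed crux
`MourreKoopmanCharges.OneBodyCompleteness` (stmt-9583) through its Galilean form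
`stub_oneBodyCompletenessGalilean` (`…LinearToEntropyInBandGalileanRung`: Cesàro decay of
`(N+1) E_{G_u}[A_h(χ)(Φ_{s(N+1)^{-1/3}} z) A_h(χ)(z)]`, `A_h(χ)(z) = (N+1)⁻¹ Σᵢ χ(xᵢ) h(vᵢ)`):

* § 1 statics at drift `u`: `A_h(χ) ∈ L²(G_u)` (velocity marginal `⊗ N(u, θ)`, `memLp_weighted`), and the exact
  equal-time variance `(N+1) E_{G_u}[A_h(χ)²] = (∫χ²) ∫ h² M_{θ,u}` (`G_u = (velShift u)_# G_0` and the centred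
  statics `succ_mul_integral_sq_oneBodyField` for `h(· + u)`), whence the `N`-uniform bound
  `(N+1) |E_{G_u}[A_h(χ) · A_h(χ)∘Φ_t]| ≤ (∫χ²) ∫ h² M_{θ,u}` (`abs_corr_le_integral_sq`);
* § 2 the window term IS the Fejér mean of the autocorrelation: the finite sum commutes with the window integral
  along a.e. orbit, then `lintegral_sq_windowAvg_eq_fejer` (drift `u`);
* § 3 Fejér from Cesàro uniformly in `N` (`fejer_le_of_cesaro`, integer anchors) after the change of variables
  `t = s(N+1)^{-1/3}`, and `limsup_N ≤` an eventual bound.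

References: H. Spohn, *Large Scale Dynamics of Interacting Particles* (1991), Part I §2.3 (Galilean invariance of
local equilibria), §7.1 (Drude weights) and Part II §1.7 (Green–Kubo); folklore otherwise.
-/

noncomputable section

namespace Summit.AtomisticToContinuum.HydrodynamicLimit.Theorems.LTEInBand

open MeasureTheory ProbabilityTheory Filter Topology Set
open Literature.Analysis.FluidPDE Literature.MathematicalPhysics.KineticTheory
open Literature.Analysis.FunctionSpaces
open scoped InnerProductSpace ENNReal BigOperators Interval
open Summit.AtomisticToContinuum.HydrodynamicLimit.Theorems
open MourreKoopmanChargesIdealGasNoDecay MourreKoopmanChargesOneBodyCompleteness KineticWindowGronwallBoost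
  EquilibriumStressVarianceDecayC3 BoltzmannGreenKuboOrthMomentum
open Summit.AtomisticToContinuum.HydrodynamicLimit.Theses

/-! ### § 1 Statics of the one-body field under the drifted canonical law -/

section Statics

variable {σ : ℝ} {N : ℕ}

/-- A continuous velocity profile of polynomial growth is in `L²(N(u, θ id))` for every drift `u` (Fernique
moments of the Gaussian law). [folklore] -/
theorem memLp_two_gaussMeasure_drift (u : V3) (θ : ℝ) {h : V3 → ℝ} (hh : Continuous h) {C : ℝ} {k : ℕ}
    (hCk : ∀ v, |h v| ≤ C * (1 + ‖v‖) ^ k) : MemLp h 2 (gaussMeasure u θ) :=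
  (memLp_two_iff_integrable_sq hh.aestronglyMeasurable).2
    (integrable_of_poly_growth _ (hh.pow 2).aestronglyMeasurable (sq_growth hCk))

/-- Each summand `z ↦ χ(xᵢ) h(vᵢ)` of the one-body field is in `L²(G_u)` under the drifted canonical law
`G_u = localGibbsLaw σ 1 u θ N Φ` (`θ > 0`, `σ ≤ 1/2`), for continuous `χ` and continuous polynomially bounded
`h`. [folklore] -/
theorem memLp_two_summand_drift {θ : ℝ} (hθ : 0 < θ) (hσ : σ ≤ 1 / 2) (u : V3)
    (Φ : HardSphereFlow (Torus.geometry (Fin 3)) (hsDiameter σ N) (N + 1)) {χ : T3 → ℝ} (hχ : Continuous χ)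
    {h : V3 → ℝ} (hh : Continuous h) {C : ℝ} {k : ℕ} (hCk : ∀ v, |h v| ≤ C * (1 + ‖v‖) ^ k)
    (i : Fin (N + 1)) :
    MemLp (fun z : Config (N + 1) (Fin 3) T3 => χ (z i).1 * h (z i).2) 2
      (localGibbsLaw σ (fun _ => 1) (fun _ => u) (fun _ => θ) N Φ) := by
  haveI := isProbabilityMeasure_localGibbsLaw_const hθ hσ u N Φ
  obtain ⟨Cχ, -, hCχ⟩ := exists_bound_of_continuous hχ
  exact memLp_weighted zero_le_one hθ u Φ hh.measurable (memLp_two_gaussMeasure_drift u θ hh hCk) hχ hCχ i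

/-- **The one-body empirical field `A_h(χ)` is in `L²(G_u)`** under the drifted canonical law, for continuous `χ`
and a continuous velocity profile `h` of polynomial growth. [folklore] -/
theorem memLp_two_oneBodyField_drift {θ : ℝ} (hθ : 0 < θ) (hσ : σ ≤ 1 / 2) (u : V3)
    (Φ : HardSphereFlow (Torus.geometry (Fin 3)) (hsDiameter σ N) (N + 1)) {χ : T3 → ℝ} (hχ : Continuous χ)
    {h : V3 → ℝ} (hh : Continuous h) {C : ℝ} {k : ℕ} (hCk : ∀ v, |h v| ≤ C * (1 + ‖v‖) ^ k) :
    MemLp (fun z : Config (N + 1) (Fin 3) T3 => ∫ y, χ y.1 * h y.2 ∂(empiricalMeasure z)) 2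
      (localGibbsLaw σ (fun _ => 1) (fun _ => u) (fun _ => θ) N Φ) := by
  have e : (fun z : Config (N + 1) (Fin 3) T3 => ∫ y, χ y.1 * h y.2 ∂(empiricalMeasure z)) =
      fun z => ((N + 1 : ℕ) : ℝ)⁻¹ * ∑ i, χ (z i).1 * h (z i).2 :=
    funext fun z => oneBodyField_eq_sum χ h z
  rw [e]
  exact (memLp_finsetSum
    (f := fun (i : Fin (N + 1)) (z : Config (N + 1) (Fin 3) T3) => χ (z i).1 * h (z i).2)
    Finset.univ fun i _ => memLp_two_summand_drift hθ hσ u Φ hχ hh hCk i).const_mul _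

/-- Maxwellian pairings are Galilean covariant: `∫ h(v + u) M_{θ,0}(v) dv = ∫ h M_{θ,u} dv`. [folklore] -/
theorem integral_translate_mul_localMaxwellian_zero {θ : ℝ} (hθ : 0 < θ) (u : V3) (h : V3 → ℝ) :
    ∫ v, h (v + u) * localMaxwellian 1 θ (0 : V3) v = ∫ v, h v * localMaxwellian 1 θ u v := by
  rw [← integral_gaussMeasure_eq_integral_mul hθ (fun v => h (v + u)), integral_mul_localMaxwellian_eq_gauss hθ u h]

/-- **Exact equal-time variance at drift `u`**: `(N+1) · E_{G_u}[A_h(χ)²] = (∫ χ²) · ∫ h² M_{θ,u}` for continuous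
`χ`, continuous polynomially bounded `h` with `∫ h M_{θ,u} = 0`, `0 < σ < 1/2`, `0 < θ`, every flow
(`G_u = (velShift u)_# G_0`, the kinematics `A_h(χ) ∘ velShift u = A_{h(· + u)}(χ)`, and the centred statics
`succ_mul_integral_sq_oneBodyField`). [folklore] -/
theorem succ_mul_integral_sq_oneBodyField_drift {θ : ℝ} (hσ : 0 < σ) (hσ2 : σ < 1 / 2) (hθ : 0 < θ) (u : V3)
    {h : V3 → ℝ} (hh : Continuous h) {C : ℝ} {k : ℕ} (hCk : ∀ v, |h v| ≤ C * (1 + ‖v‖) ^ k)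
    (h1 : ∫ v, h v * localMaxwellian 1 θ u v = 0) (N : ℕ)
    (Φ : HardSphereFlow (Torus.geometry (Fin 3)) (hsDiameter σ N) (N + 1)) {χ : T3 → ℝ} (hχ : Continuous χ) :
    ((N : ℝ) + 1) * ∫ z, (∫ y, χ y.1 * h y.2 ∂(empiricalMeasure z)) ^ 2
        ∂(localGibbsLaw σ (fun _ => 1) (fun _ => u) (fun _ => θ) N Φ) =
      (∫ x, χ x * χ x) * ∫ v, h v ^ 2 * localMaxwellian 1 θ u v := by
  have hg : Continuous fun v => h (v + u) := hh.comp (continuous_id.add continuous_const)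
  have hgpoly : ∃ (C' : ℝ) (k' : ℕ), ∀ v, |h (v + u)| ≤ C' * (1 + ‖v‖) ^ k' :=
    ⟨_, k, poly_growth_translate hCk u⟩
  have hg1 : ∫ v, h (v + u) * localMaxwellian 1 θ (0 : V3) v = 0 := by
    rw [integral_translate_mul_localMaxwellian_zero hθ u h]
    exact h1
  have hmap := integral_localGibbsLaw_velShift σ 1 hθ 0 u N Φ Φ
    (fun z => (∫ y, χ y.1 * h y.2 ∂(empiricalMeasure z)) ^ 2)
  rw [zero_add] at hmap
  rw [hmap, ← integral_translate_mul_localMaxwellian_zero hθ u (fun v => h v ^ 2),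
    ← succ_mul_integral_sq_oneBodyField hσ hσ2 hθ hg hgpoly hg1 N Φ hχ]
  congr 1
  refine integral_congr_ae (Eventually.of_forall fun z => ?_)
  dsimp only
  rw [velShift_eq_boostAt_zero, oneBodyField_boostAt χ h u 0]
  simp only [zero_smul, Torus.proj_zero, add_zero]

/-- **`N`-uniform static bound of the two-time correlation at drift `u`**:
`(N+1) |E_{G_u}[A_h(χ) · A_h(χ)∘Φ_t]| ≤ (∫ χ²) · ∫ h² M_{θ,u}` for every `t` (`abs_corr_le_integral_sq`:
`|ab| ≤ (a² + b²)/2` and invariance of `G_u`, then the exact statics). [folklore] -/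
theorem succ_mul_abs_corr_oneBodyField_le {θ : ℝ} (hσ : 0 < σ) (hσ2 : σ < 1 / 2) (hθ : 0 < θ) (u : V3)
    {h : V3 → ℝ} (hh : Continuous h) {C : ℝ} {k : ℕ} (hCk : ∀ v, |h v| ≤ C * (1 + ‖v‖) ^ k)
    (h1 : ∫ v, h v * localMaxwellian 1 θ u v = 0) (N : ℕ)
    (Φ : HardSphereFlow (Torus.geometry (Fin 3)) (hsDiameter σ N) (N + 1)) {χ : T3 → ℝ} (hχ : Continuous χ)
    (t : ℝ) :
    ((N : ℝ) + 1) * |∫ z, (∫ y, χ y.1 * h y.2 ∂(empiricalMeasure z)) *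
        (∫ y, χ y.1 * h y.2 ∂(empiricalMeasure (Φ.flow t z)))
        ∂(localGibbsLaw σ (fun _ => 1) (fun _ => u) (fun _ => θ) N Φ)| ≤
      (∫ x, χ x * χ x) * ∫ v, h v ^ 2 * localMaxwellian 1 θ u v := by
  haveI := isProbabilityMeasure_localGibbsLaw_const hθ hσ2.le u N Φ
  have hb := abs_corr_le_integral_sq 1 θ u Φ (measurable_oneBodyField hχ hh)
    (memLp_two_oneBodyField_drift hθ hσ2.le u Φ hχ hh hCk) t
  rw [← succ_mul_integral_sq_oneBodyField_drift hσ hσ2 hθ u hh hCk h1 N Φ hχ]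
  exact mul_le_mul_of_nonneg_left hb (by positivity)

end Statics

/-! ### § 2 The window term is the Fejér mean of the autocorrelation -/

section Window

variable {σ : ℝ} {N : ℕ}

/-- **The item's integrand is the window average of the one-body field**, `G_u`-almost everywhere: for `w > 0`,
`(N+1)⁻¹ Σᵢ w⁻¹∫₀ʷ χ(xᵢ(r)) h(vᵢ(r)) dr = w⁻¹ ∫₀ʷ A_h(χ)(Φ_r z) dr` (the finite sum and the time integral commute
along every orbit with integrable sections, which is a.e. every orbit). [folklore] -/
theorem ae_windowAvg_sum_eq_windowAvg_oneBodyField {θ : ℝ} (hθ : 0 < θ) (hσ : σ ≤ 1 / 2) (u : V3)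
    (Φ : HardSphereFlow (Torus.geometry (Fin 3)) (hsDiameter σ N) (N + 1)) {χ : T3 → ℝ} (hχ : Continuous χ)
    {h : V3 → ℝ} (hh : Continuous h) {C : ℝ} {k : ℕ} (hCk : ∀ v, |h v| ≤ C * (1 + ‖v‖) ^ k)
    {w : ℝ} (hw : 0 < w) :
    ∀ᵐ z ∂(localGibbsLaw σ (fun _ => 1) (fun _ => u) (fun _ => θ) N Φ),
      ((N : ℝ) + 1)⁻¹ * ∑ i : Fin (N + 1),
          (w⁻¹ * ∫ r in (0 : ℝ)..w, χ ((Φ.flow r z i).1) * h ((Φ.flow r z i).2)) =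
        w⁻¹ * ∫ r in (0 : ℝ)..w, (∫ y, χ y.1 * h y.2 ∂(empiricalMeasure (Φ.flow r z))) := by
  -- adapted from EquilibriumStressVarianceDecayC3.ae_item_integrand_eq
  haveI := isProbabilityMeasure_localGibbsLaw_const hθ hσ u N Φ
  set G := localGibbsLaw σ (fun _ => 1) (fun _ => u) (fun _ => θ) N Φ with hGdef
  set Xi : Fin (N + 1) → Config (N + 1) (Fin 3) T3 → ℝ := fun i z => χ (z i).1 * h (z i).2 with hXi
  have hXi2 : ∀ i, MemLp (Xi i) 2 G := fun i => memLp_two_summand_drift hθ hσ u Φ hχ hh hCk i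
  have hXim : ∀ i, Measurable (Xi i) := fun i =>
    (hχ.measurable.comp (measurable_pi_apply i).fst).mul (hh.measurable.comp (measurable_pi_apply i).snd)
  have hseci : ∀ᵐ z ∂G, ∀ i, IntegrableOn (fun r => Xi i (Φ.flow r z)) (Ioc (0 : ℝ) w) := by
    rw [ae_all_iff]
    exact fun i => (integrable_comp_flow_prod 1 θ u Φ (hXim i) ((hXi2 i).integrable one_le_two) w).prod_left_ae
  filter_upwards [hseci] with z hzi
  have hii : ∀ i ∈ (Finset.univ : Finset (Fin (N + 1))),
      IntervalIntegrable (fun r => Xi i (Φ.flow r z)) volume 0 w :=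
    fun i _ => (intervalIntegrable_iff_integrableOn_Ioc_of_le hw.le).2 (hzi i)
  have e1 : ∑ i : Fin (N + 1), (w⁻¹ * ∫ r in (0 : ℝ)..w, χ ((Φ.flow r z i).1) * h ((Φ.flow r z i).2)) =
      w⁻¹ * ∫ r in (0 : ℝ)..w, ∑ i : Fin (N + 1), Xi i (Φ.flow r z) := by
    rw [← Finset.mul_sum, ← intervalIntegral.integral_finsetSum hii]
  have e2 : (fun r => ∫ y, χ y.1 * h y.2 ∂(empiricalMeasure (Φ.flow r z))) =
      fun r => ((N + 1 : ℕ) : ℝ)⁻¹ * ∑ i : Fin (N + 1), Xi i (Φ.flow r z) := by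
    funext r
    exact oneBodyField_eq_sum χ h (Φ.flow r z)
  rw [e1, e2, intervalIntegral.integral_const_mul]
  push_cast
  ring

/-- **GREEN–KUBO / FEJÉR FORM OF THE WINDOW VARIANCE at drift `u`** (every `N`, every flow, every window
`w > 0`): `(N+1) · ∫⁻ ofReal(((N+1)⁻¹ Σᵢ w⁻¹∫₀ʷ χ(xᵢ(r)) h(vᵢ(r)) dr)²) dG_u = ofReal((N+1) · 2w⁻² ∫₀ʷ (w − t) C_N(t) dt)`
with `C_N(t) = E_{G_u}[A_h(χ) · A_h(χ)∘Φ_t]`. [folklore] -/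
theorem windowVariance_eq_fejer {θ : ℝ} (hθ : 0 < θ) (hσ : σ ≤ 1 / 2) (u : V3)
    (Φ : HardSphereFlow (Torus.geometry (Fin 3)) (hsDiameter σ N) (N + 1)) {χ : T3 → ℝ} (hχ : Continuous χ)
    {h : V3 → ℝ} (hh : Continuous h) {C : ℝ} {k : ℕ} (hCk : ∀ v, |h v| ≤ C * (1 + ‖v‖) ^ k)
    {w : ℝ} (hw : 0 < w) :
    ((N : ℝ≥0∞) + 1) * ∫⁻ z, ENNReal.ofReal ((((N : ℝ) + 1)⁻¹ * ∑ i : Fin (N + 1),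
        (w⁻¹ * ∫ r in (0 : ℝ)..w, χ ((Φ.flow r z i).1) * h ((Φ.flow r z i).2))) ^ 2)
        ∂(localGibbsLaw σ (fun _ => 1) (fun _ => u) (fun _ => θ) N Φ) =
      ENNReal.ofReal (((N : ℝ) + 1) * (2 * w⁻¹ ^ 2 * ∫ t in (0 : ℝ)..w, (w - t) *
        ∫ z, (∫ y, χ y.1 * h y.2 ∂(empiricalMeasure z)) *
          (∫ y, χ y.1 * h y.2 ∂(empiricalMeasure (Φ.flow t z)))
          ∂(localGibbsLaw σ (fun _ => 1) (fun _ => u) (fun _ => θ) N Φ))) := by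
  -- adapted from EquilibriumStressVarianceDecayC3.item_term_eq_fejer
  haveI := isProbabilityMeasure_localGibbsLaw_const hθ hσ u N Φ
  set G := localGibbsLaw σ (fun _ => 1) (fun _ => u) (fun _ => θ) N Φ with hGdef
  have e : ∫⁻ z, ENNReal.ofReal ((((N : ℝ) + 1)⁻¹ * ∑ i : Fin (N + 1),
        (w⁻¹ * ∫ r in (0 : ℝ)..w, χ ((Φ.flow r z i).1) * h ((Φ.flow r z i).2))) ^ 2) ∂G =
      ∫⁻ z, ENNReal.ofReal ((w⁻¹ * ∫ r in (0 : ℝ)..w,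
        (∫ y, χ y.1 * h y.2 ∂(empiricalMeasure (Φ.flow r z)))) ^ 2) ∂G := by
    refine lintegral_congr_ae ?_
    filter_upwards [ae_windowAvg_sum_eq_windowAvg_oneBodyField hθ hσ u Φ hχ hh hCk hw] with z hz
    rw [hz]
  have hcast : ((N : ℝ≥0∞) + 1) = ENNReal.ofReal ((N : ℝ) + 1) := by
    rw [ENNReal.ofReal_add (Nat.cast_nonneg N) zero_le_one, ENNReal.ofReal_natCast, ENNReal.ofReal_one]
  rw [e, lintegral_sq_windowAvg_eq_fejer 1 θ u Φ (measurable_oneBodyField hχ hh)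
    (memLp_two_oneBodyField_drift hθ hσ u Φ hχ hh hCk) hw, hcast, ← ENNReal.ofReal_mul (by positivity)]

end Window

/-! ### § 3 Fejér from Cesàro and the registered stub -/

section Rung

/-- **Smallness of the rescaled Fejér means gives the double limit** (abstract kernel form of
`fejerStress_of_kernel_small`): for correlation kernels `C_N` and `K_N(s) = (N+1) C_N(s(N+1)^{-1/3})`, if
`∀ ε > 0 ∃ T₀ ∀ τ ≥ T₀ ∃ N₀ ∀ N ≥ N₀, 2τ⁻² ∫₀^τ (τ − s) K_N(s) ds ≤ ε` then
`lim_{τ→∞} limsup_N ofReal((N+1) · 2w⁻² ∫₀ʷ (w − t) C_N(t) dt) = 0`, `w = τ(N+1)^{-1/3}` (change of variables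
`t = s(N+1)^{-1/3}`, then `limsup ≤` an eventual bound). [folklore] -/
theorem fejer_limsup_tendsto_zero_of_small (C : ℕ → ℝ → ℝ)
    (hsmall : ∀ ε : ℝ, 0 < ε → ∃ T₀ : ℝ, 0 < T₀ ∧ ∀ τ : ℝ, T₀ ≤ τ → ∃ N₀ : ℕ, ∀ N : ℕ, N₀ ≤ N →
      2 * τ⁻¹ ^ 2 * ∫ s in (0 : ℝ)..τ, (τ - s) * (((N : ℝ) + 1) * C N (s * ((N : ℝ) + 1) ^ (-(1 / 3 : ℝ)))) ≤ ε) :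
    Tendsto (fun τ : ℝ => Filter.limsup (fun N : ℕ => ENNReal.ofReal (((N : ℝ) + 1) *
      (2 * (τ * ((N : ℝ) + 1) ^ (-(1 / 3 : ℝ)))⁻¹ ^ 2 *
        ∫ t in (0 : ℝ)..(τ * ((N : ℝ) + 1) ^ (-(1 / 3 : ℝ))), (τ * ((N : ℝ) + 1) ^ (-(1 / 3 : ℝ)) - t) *
          C N t))) atTop) atTop (𝓝 0) := by
  -- adapted from fejerStress_of_kernel_small
  set c : ℕ → ℝ := fun N => ((N : ℝ) + 1) ^ (-(1 / 3 : ℝ)) with hc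
  have hcpos : ∀ N, 0 < c N := fun N => Real.rpow_pos_of_pos (by positivity) _
  set Kf : ℕ → ℝ → ℝ := fun N s => ((N : ℝ) + 1) * C N (s * c N) with hKf
  -- change of variables `t = s · c N` in the Fejér functional
  have hcv : ∀ N : ℕ, ∀ τ : ℝ, ((N : ℝ) + 1) * (2 * (τ * c N)⁻¹ ^ 2 *
      ∫ t in (0 : ℝ)..(τ * c N), (τ * c N - t) * C N t) = 2 * τ⁻¹ ^ 2 * ∫ s in (0 : ℝ)..τ, (τ - s) * Kf N s := by
    intro N τ
    have hcN := (hcpos N).ne'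
    have hsub : ∫ s in (0 : ℝ)..τ, (τ * c N - s * c N) * C N (s * c N) =
        (c N)⁻¹ * ∫ t in (0 * c N)..(τ * c N), (τ * c N - t) * C N t := by
      rw [← smul_eq_mul (c N)⁻¹, ← intervalIntegral.integral_comp_mul_right (fun t => (τ * c N - t) * C N t) hcN]
    rw [zero_mul] at hsub
    have hKint : ∫ s in (0 : ℝ)..τ, (τ - s) * Kf N s =
        ((N : ℝ) + 1) * (c N)⁻¹ * ∫ s in (0 : ℝ)..τ, (τ * c N - s * c N) * C N (s * c N) := by
      rw [mul_assoc, ← intervalIntegral.integral_const_mul, ← intervalIntegral.integral_const_mul]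
      refine intervalIntegral.integral_congr fun s _ => ?_
      simp only [hKf]
      field_simp
    rw [hKint, hsub]
    field_simp
  -- conclude: `∀ ε > 0`, eventually in `τ`, `limsup_N ofReal(…) ≤ ε`
  rw [ENNReal.tendsto_nhds_zero]
  intro ε hε
  by_cases hεtop : ε = ⊤
  · exact Eventually.of_forall fun τ => hεtop ▸ le_top
  have hεr : 0 < ε.toReal := ENNReal.toReal_pos hε.ne' hεtop
  obtain ⟨T₀, hT₀, hT⟩ := hsmall ε.toReal hεr
  filter_upwards [eventually_ge_atTop T₀] with τ hτ
  obtain ⟨N₀, hN₀⟩ := hT τ hτ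
  refine Filter.limsup_le_of_le (h := ?_)
  filter_upwards [eventually_ge_atTop N₀] with N hN
  rw [hcv N τ]
  calc ENNReal.ofReal (2 * τ⁻¹ ^ 2 * ∫ s in (0 : ℝ)..τ, (τ - s) * Kf N s)
      ≤ ENNReal.ofReal ε.toReal := ENNReal.ofReal_le_ofReal (hN₀ N hN)
    _ = ε := ENNReal.ofReal_toReal hεtop

/-- **Registered stub `stub_windowVarianceGalilean` of crux stmt-AtomisticToContinuum-17740 — THE WINDOW-VARIANCE
(FEJÉR) FORM OF `OneBodyCompleteness` AT EVERY DRIFT AND EVERY ADMISSIBLE ONE-BODY FIELD, the `L²` shadow of the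
kinetic rows of visible flux-Gibbsianity in its own quantifier order (window `τ → ∞` after `N → ∞`).**
`OneBodyCompleteness` (stmt-9583) gives `σ₀ > 0` such that for `0 < σ < σ₀`, `θ > 0`, every drift `u`, every
continuous polynomially bounded `h ⊥ {1, vᵢ, |v|²}` in `L²(M_{θ,u})`, every flow family and every continuous `χ`:
`lim_{τ→∞} limsup_N (N+1) · E_{G_u}[((N+1)⁻¹ Σᵢ w_N⁻¹∫₀^{w_N} χ(xᵢ(r)) h(vᵢ(r)) dr)²] = 0`, `w_N = τ(N+1)^{-1/3}`,
`G_u = localGibbsLaw σ 1 u θ N Φ_N`.  Proof: the Galilean rung `stub_oneBodyCompletenessGalilean` is the Cesàro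
hypothesis of `fejer_le_of_cesaro` for `K_N(s) = (N+1) C_N(s(N+1)^{-1/3})`, `C_N(t) = E_{G_u}[A_h(χ) · A_h(χ)∘Φ_t]`
(measurable by `measurable_corr`, `|K_N| ≤ (∫χ²)∫h²M_{θ,u}` by § 1); the window term is the Fejér mean of `C_N`
(§ 2); then `fejer_limsup_tendsto_zero_of_small`. [folklore] -/
theorem stub_windowVarianceGalilean : Summit.AtomisticToContinuum.HydrodynamicLimit.Theses.MourreKoopmanCharges.OneBodyCompleteness → ∃ σ₀ : ℝ, 0 < σ₀ ∧ ∀ σ : ℝ, 0 < σ → σ < σ₀ → ∀ θ : ℝ, 0 < θ → ∀ u : Literature.MathematicalPhysics.KineticTheory.V3, ∀ h : Literature.MathematicalPhysics.KineticTheory.V3 → ℝ, Continuous h → (∃ (C : ℝ) (k : ℕ), ∀ v, |h v| ≤ C * (1 + ‖v‖) ^ k) → (∫ v, h v * Literature.Analysis.FluidPDE.localMaxwellian 1 θ u v = 0) → (∀ i : Fin 3, ∫ v, h v * v i * Literature.Analysis.FluidPDE.localMaxwellian 1 θ u v = 0) → (∫ v, h v * ‖v‖ ^ 2 * Literature.Analysis.FluidPDE.localMaxwellian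 1 θ u v = 0) → ∀ Φ : (N : ℕ) → Literature.Analysis.FluidPDE.HardSphereFlow (Literature.Analysis.FluidPDE.Torus.geometry (Fin 3)) (Literature.MathematicalPhysics.KineticTheory.hsDiameter σ N) (N + 1), ∀ χ : Literature.MathematicalPhysics.KineticTheory.T3 → ℝ, Continuous χ → Filter.Tendsto (fun τ : ℝ => Filter.limsup (fun N : ℕ => ((N : ENNReal) + 1) * ∫⁻ z, ENNReal.ofReal ((((N : ℝ) + 1)⁻¹ * ∑ i : Fin (N + 1), (τ * ((N : ℝ) + 1) ^ (-(1 / 3 : ℝ)))⁻¹ * ∫ r in (0 : ℝ)..(τ * ((N : ℝ) + 1) ^ (-(1 / 3 : ℝ))), χ ((Φ N).flow r z i).1 * h ((Φ N).flow r z i).2) ^ 2) ∂(Literature.MathematicalPhysics.KineticTheory.localGibbsLaw σ (fun _ => 1) (fun _ => u) (fun _ => θ) N (Φ N))) Filter.atTop) Filter.atTop (nhds 0) := by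
  intro hOBC
  obtain ⟨σ₁, hσ₁, HG⟩ := stub_oneBodyCompletenessGalilean hOBC
  refine ⟨min σ₁ (1 / 2), lt_min hσ₁ (by norm_num), ?_⟩
  intro σ hσ hσlt θ hθ u h hh hpoly h1 h2 h3 Φ χ hχ
  have hσ₁' : σ < σ₁ := lt_of_lt_of_le hσlt (min_le_left _ _)
  have hσ2 : σ < 1 / 2 := lt_of_lt_of_le hσlt (min_le_right _ _)
  obtain ⟨C, k, hCk⟩ := hpoly
  haveI hprob : ∀ N : ℕ,
      IsProbabilityMeasure (localGibbsLaw σ (fun _ => (1 : ℝ)) (fun _ => u) (fun _ => θ) N (Φ N)) :=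
    fun N => isProbabilityMeasure_localGibbsLaw_const hθ hσ2.le u N (Φ N)
  -- the autocorrelation of the one-body field under `G_u`
  set Cr : ℕ → ℝ → ℝ := fun N t => ∫ z, (∫ y, χ y.1 * h y.2 ∂(empiricalMeasure z)) *
      (∫ y, χ y.1 * h y.2 ∂(empiricalMeasure ((Φ N).flow t z)))
      ∂(localGibbsLaw σ (fun _ => (1 : ℝ)) (fun _ => u) (fun _ => θ) N (Φ N)) with hCr
  -- (A) the Fejér functional of `Cr` tends to zero: Fejér from Cesàro, uniformly in `N`
  have hF : Tendsto (fun τ : ℝ => Filter.limsup (fun N : ℕ => ENNReal.ofReal (((N : ℝ) + 1) *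
      (2 * (τ * ((N : ℝ) + 1) ^ (-(1 / 3 : ℝ)))⁻¹ ^ 2 *
        ∫ t in (0 : ℝ)..(τ * ((N : ℝ) + 1) ^ (-(1 / 3 : ℝ))), (τ * ((N : ℝ) + 1) ^ (-(1 / 3 : ℝ)) - t) *
          Cr N t))) atTop) atTop (𝓝 0) := by
    refine fejer_limsup_tendsto_zero_of_small Cr ?_
    set c : ℕ → ℝ := fun N => ((N : ℝ) + 1) ^ (-(1 / 3 : ℝ)) with hc
    set Kf : ℕ → ℝ → ℝ := fun N s => ((N : ℝ) + 1) * Cr N (s * c N) with hKf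
    -- the three inputs of `fejer_le_of_cesaro`
    have hKm : ∀ N, Measurable (Kf N) := by
      intro N
      have hm := measurable_corr 1 θ u (Φ N) (measurable_oneBodyField (n := N + 1) hχ hh)
      exact (hm.comp (measurable_id.mul_const (c N))).const_mul _
    set B : ℝ := (∫ x, χ x * χ x) * ∫ v, h v ^ 2 * localMaxwellian 1 θ u v with hB
    have hB0 : 0 ≤ B := by
      rw [hB]
      exact mul_nonneg (integral_nonneg fun x => mul_self_nonneg _)
        (integral_nonneg fun v => mul_nonneg (sq_nonneg _) (localMaxwellian_nonneg zero_le_one hθ.le _ _))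
    have hKB : ∀ N s, |Kf N s| ≤ B := by
      intro N s
      rw [hKf]
      dsimp only
      rw [abs_mul, abs_of_pos (by positivity : (0 : ℝ) < (N : ℝ) + 1)]
      exact succ_mul_abs_corr_oneBodyField_le hσ hσ2 hθ u hh hCk h1 N (Φ N) hχ _
    have hces : ∀ δ : ℝ, 0 < δ → ∃ S₀ : ℝ, 0 < S₀ ∧ ∀ S : ℝ, S₀ ≤ S → ∃ N₀ : ℕ, ∀ N : ℕ, N₀ ≤ N →
        |S⁻¹ * ∫ s in (0 : ℝ)..S, Kf N s| ≤ δ := by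
      intro δ hδ
      obtain ⟨S₀, hS₀, hS⟩ := HG σ hσ hσ₁' θ hθ u h hh ⟨C, k, hCk⟩ h1 h2 h3 Φ χ hχ δ hδ
      refine ⟨S₀, hS₀, fun S hSS => ?_⟩
      obtain ⟨N₀, hN₀⟩ := hS S hSS
      refine ⟨N₀, fun N hN => ?_⟩
      have key : (fun s : ℝ => ((N : ℝ) + 1) * ∫ z,
          (∫ y, χ y.1 * h y.2 ∂(empiricalMeasure ((Φ N).flow (s * ((N : ℝ) + 1) ^ (-(1 / 3 : ℝ))) z))) *
            (∫ y, χ y.1 * h y.2 ∂(empiricalMeasure z))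
          ∂(localGibbsLaw σ (fun _ => (1 : ℝ)) (fun _ => u) (fun _ => θ) N (Φ N))) = Kf N := by
        funext s
        rw [hKf, hCr]
        dsimp only
        congr 1
        refine integral_congr_ae (Eventually.of_forall fun z => ?_)
        dsimp only
        rw [mul_comm]
      have hb := hN₀ N hN
      rw [key] at hb
      exact hb
    exact fejer_le_of_cesaro hKm hB0 hKB hces
  -- (B) the window variance IS the Fejér functional of `Cr`, window by window (`τ > 0`)
  refine hF.congr' ?_
  filter_upwards [eventually_gt_atTop (0 : ℝ)] with τ hτ
  refine congr_arg (fun f : ℕ → ℝ≥0∞ => Filter.limsup f atTop) (funext fun N => ?_)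
  exact (windowVariance_eq_fejer hθ hσ2.le u (Φ N) hχ hh hCk (kineticWindow_pos hτ N)).symm

end Rung

end Summit.AtomisticToContinuum.HydrodynamicLimit.Theorems.LTEInBand

end
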